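import Summits.QuantumFields.YangMills.Theses.FemtoCutoffLadder
import Summits.QuantumFields.YangMills.Theorems.FemtoCutoffLadderOneSiteWindowAnchor

/-!
# Route `FemtoCutoffLadder` (QuantumFields / YangMills; rung R2b1 leaf `FemtoTransferGap.FemtoGapOfRecord`) — support item
# `OneSiteGapUpper` (stmt-QuantumFields-23944, child of crux r3 `CoarsePairScaling`), PROVED: the REVERSE one-site law in window currency

Lead seat `ym-line-fcl-p1` (2026-08-28).  `z(β,1) ≤ ε₁Λ + CΛ²` deep in the window, i.e. `e^{−(ε₁Λ + CΛ²)}·λ₀(β,1) ≤ λ₁(β,1)` with the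
RUNNING parameter `Λ = luscherLambda β 1`: from the LOWER half of the closed crux ONE of route `LuscherReduction` (`oneSiteLevels_proof`,
level `k = 1`, `levelGap_one : levelGap 1 = ε₁`, bare parameter `λ_b`, `β ≥ B₀`) and the one-site label comparison
`0 ≤ Λ − λ_b ≤ KΛ²`, `K = (b₁/b₀)(3 − log 2b₀)` (`FemtoCutoffLadderOneSiteWindowAnchor.lean`), with `β ≥ B₀` deep in the window.

* `oneSiteGapUpper` — the spelled-out statement (= verbatim body of the registered stub `OneSiteGapUpper` of the r3 skeleton `BirthR`;
  there: `theorem stub_oneSiteGapUpper : OneSiteGapUpper := FemtoCutoffLadder.oneSiteGapUpper`);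
* ★ `oneSiteGapUpper_proof : Theses.FemtoCutoffLadder.OneSiteGapUpper` (the item, by name).

HONEST FRAMING: the `L = 1` three-matrix model only; nothing about `L ≥ 2`, infinite volume, a mass gap or Clay; R2b1 is a RECORD rung.
No definitions, no named facts, no `sorry`.
-/

set_option autoImplicit false

noncomputable section

namespace Summit.QuantumFields.YangMills.Theorems.FemtoCutoffLadder

open Real
open Summit.QuantumFields.YangMills.Theorems.FemtoTransferGap
open Literature.Analysis.OperatorTheory.YMMatrixModel (luscherEps1)

/-! ## §1 The one-site UPPER stub (reverse Lüscher law at `L = 1`, running parameter) -/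

/-- ★ **`OneSiteGapUpper` (registered stub of crux r3, rev 3), PROVED** — verbatim body: there are `C`, `lam0 > 0` with
`e^{−(ε₁Λ(β,1) + CΛ(β,1)²)}·λ₀(β,1) ≤ λ₁(β,1)` for every one-site window point of depth `lam ≤ lam0`.  From the LOWER half of crux ONE at
level `k = 1` (`e^{−(ε₁λ_b + Cλ_b²)} μ₀ ≤ μ₁`, `β ≥ B₀`) and `0 ≤ Λ − λ_b ≤ KΛ²`, `λ_b ≤ Λ ≤ 1`; constants `C' = |ε₁|K + |C|`,
`lam0 = min(1/2, 1/(4 max(B₀,1)))`. [cite: Luscher1983, §2] [cite: LuscherMunster1984, §2] -/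
theorem oneSiteGapUpper :
    ∃ C lam0 : ℝ, 0 < lam0 ∧ ∀ lam : ℝ, 0 < lam → lam ≤ lam0 → ∀ β : ℝ, InFemtoWindow lam β 1 →
      Real.exp (-(luscherEps1 * luscherLambda β 1 + C * luscherLambda β 1 ^ 2)) * topValue su2Rep 1 β ≤
        secondValue su2Rep 1 β := by
  have hONE : ∀ k : ℕ, ∃ C B0 : ℝ, ∀ B : ℝ, B0 ≤ B → 0 < levelValue su2Rep 1 B 0 ∧
      levelValue su2Rep 1 B k ≤ Real.exp (-(levelGap k * bareLambda B - C * bareLambda B ^ 2)) * levelValue su2Rep 1 B 0 ∧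
        Real.exp (-(levelGap k * bareLambda B + C * bareLambda B ^ 2)) * levelValue su2Rep 1 B 0 ≤ levelValue su2Rep 1 B k :=
    oneSiteLevels_proof
  obtain ⟨C, B0, H⟩ := hONE 1
  set K : ℝ := (b1 / b0) * (3 - Real.log (2 * b0)) with hK
  have hKpos : 0 < K := anchorK_pos
  set M : ℝ := max B0 1 with hM
  have hM1 : 1 ≤ M := le_max_right _ _
  have hMpos : 0 < M := by linarith
  refine ⟨|luscherEps1| * K + |C|, min (1 / 2) (1 / (4 * M)), lt_min (by norm_num) (by positivity), ?_⟩
  intro lam hlam hle β hW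
  have hhalf : lam ≤ 1 / 2 := hle.trans (min_le_left _ _)
  have hlamM : lam ≤ 1 / (4 * M) := hle.trans (min_le_right _ _)
  have hlam1 : lam ≤ 1 := by linarith
  have hβ1 : 1 ≤ β := hW.1
  have hβ0 : 0 < β := by linarith
  have hβge : B0 ≤ β :=
    ((le_max_left _ _).trans (BOHandover.le_of_small_lam hM1 hlam hlam1 hlamM)).trans
      (BOHandover.beta_ge_of_window (L0 := 1) hlam hW)
  obtain ⟨-, -, hlow⟩ := H β hβge
  rw [levelValue_one, levelValue_zero, levelGap_one] at hlow
  set Λ : ℝ := luscherLambda β 1 with hΛ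
  set l : ℝ := bareLambda β with hl_def
  have hΛpos : 0 < Λ := luscherLambda_pos_of_window hlam hW
  have hΛ1 : Λ ≤ 1 := by have := hW.2.2; linarith
  have hlΛ : l ≤ Λ := bareLambda_le_luscherLambda_one hβ1 hΛpos
  have hlpos : 0 < l := bareLambda_pos' hβ0
  have hdiff : Λ - l ≤ K * Λ ^ 2 := luscherLambda_sub_bareLambda_le hβ1 hΛpos hΛ1
  have hexp : -(luscherEps1 * Λ + (|luscherEps1| * K + |C|) * Λ ^ 2) ≤ -(luscherEps1 * l + C * l ^ 2) := by
    have h1 : -(luscherEps1 * (Λ - l)) ≤ |luscherEps1| * (K * Λ ^ 2) := by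
      calc -(luscherEps1 * (Λ - l)) ≤ |luscherEps1| * (Λ - l) := by
            have := neg_abs_le luscherEps1
            nlinarith
        _ ≤ |luscherEps1| * (K * Λ ^ 2) := mul_le_mul_of_nonneg_left hdiff (abs_nonneg _)
    have h2 : C * l ^ 2 ≤ |C| * Λ ^ 2 := by
      calc C * l ^ 2 ≤ |C| * l ^ 2 := mul_le_mul_of_nonneg_right (le_abs_self _) (sq_nonneg _)
        _ ≤ |C| * Λ ^ 2 := mul_le_mul_of_nonneg_left (pow_le_pow_left₀ hlpos.le hlΛ 2) (abs_nonneg _)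
    nlinarith
  exact (mul_le_mul_of_nonneg_right (Real.exp_le_exp.mpr hexp) (topValue_nonneg su2Rep 1 β)).trans hlow

/-- ★ **THE SUPPORT ITEM `OneSiteGapUpper` (stmt-QuantumFields-23944), PROVED** (by name). [cite: Luscher1983, §2] -/
theorem oneSiteGapUpper_proof : Summit.QuantumFields.YangMills.Theses.FemtoCutoffLadder.OneSiteGapUpper :=
  oneSiteGapUpper

end Summit.QuantumFields.YangMills.Theorems.FemtoCutoffLadder

end
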